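import Mathlib

/-!
# SoloBlind — backward discrete Gronwall lemma (outer zone [O1], PLAN §119.12)

If a sequence `ε` vanishes at the horizon `N` and satisfies the Volterra-type inequality
`‖ε k‖ ≤ ∑_{j ∈ (k, N]} κ j * (1 + ‖ε j‖)` for all `k < N` with `κ ≥ 0`, then
`‖ε k‖ ≤ ∏_{j ∈ (k, N]} (1 + κ j) - 1 ≤ exp (∑_{j ∈ (k, N]} κ j) - 1` for all `k ≤ N`.
This is the estimate that converts the Volterra representation of the recessive solution
(`SoloBlindDiscreteLG.volterra_sum`) into the LG error bound `‖ε‖ ≤ e^{C V} - 1`.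
-/

namespace Summit.AnomalousDissipation.SoloBlind.BackwardGronwall

open Finset Real

/-- Telescoping: `∑_{j ∈ [a, b)} κ j * ∏_{i ∈ [j+1, b)} (1 + κ i) = ∏_{i ∈ [a, b)} (1 + κ i) - 1`. -/
theorem telescope (κ : ℕ → ℝ) (a b : ℕ) (hab : a ≤ b) :
    ∑ j ∈ Ico a b, κ j * ∏ i ∈ Ico (j + 1) b, (1 + κ i) = ∏ i ∈ Ico a b, (1 + κ i) - 1 := by
  induction b, hab using Nat.le_induction with
  | base => simp
  | succ b hab ih =>
    rw [sum_Ico_succ_top hab, prod_Ico_succ_top hab]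
    have hinner : ∑ j ∈ Ico a b, κ j * ∏ i ∈ Ico (j + 1) (b + 1), (1 + κ i)
        = (∑ j ∈ Ico a b, κ j * ∏ i ∈ Ico (j + 1) b, (1 + κ i)) * (1 + κ b) := by
      rw [sum_mul]
      refine sum_congr rfl (fun j hj => ?_)
      rw [mem_Ico] at hj
      rw [prod_Ico_succ_top (by omega : j + 1 ≤ b)]
      ring
    rw [hinner, ih, Finset.Ico_self, Finset.prod_empty]
    ring

/-- Backward discrete Gronwall. -/
theorem backward_gronwall (ε : ℕ → ℂ) (κ : ℕ → ℝ) (N : ℕ) (hκ : ∀ j, 0 ≤ κ j) (hN : ε N = 0)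
    (h : ∀ k, k < N → ‖ε k‖ ≤ ∑ j ∈ Ico (k + 1) (N + 1), κ j * (1 + ‖ε j‖)) :
    ∀ k, k ≤ N → ‖ε k‖ ≤ ∏ j ∈ Ico (k + 1) (N + 1), (1 + κ j) - 1 := by
  -- strong downward induction on n = N - k
  suffices hs : ∀ n k, N - k = n → k ≤ N → ‖ε k‖ ≤ ∏ j ∈ Ico (k + 1) (N + 1), (1 + κ j) - 1 by
    intro k hk; exact hs (N - k) k rfl hk
  intro n
  induction n using Nat.strong_induction_on with
  | _ n ih =>
    intro k hkn hkN
    rcases Nat.eq_or_lt_of_le hkN with heq | hlt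
    · -- k = N
      rw [heq, hN, norm_zero, Finset.Ico_self, Finset.prod_empty]
      norm_num
    · have hk := h k hlt
      refine hk.trans ?_
      have hbound : ∑ j ∈ Ico (k + 1) (N + 1), κ j * (1 + ‖ε j‖)
          ≤ ∑ j ∈ Ico (k + 1) (N + 1), κ j * ∏ i ∈ Ico (j + 1) (N + 1), (1 + κ i) := by
        refine sum_le_sum (fun j hj => ?_)
        rw [mem_Ico] at hj
        refine mul_le_mul_of_nonneg_left ?_ (hκ j)
        have hj' : ‖ε j‖ ≤ ∏ i ∈ Ico (j + 1) (N + 1), (1 + κ i) - 1 :=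
          ih (N - j) (by omega) j rfl (by omega)
        linarith
      refine hbound.trans ?_
      rw [telescope κ (k + 1) (N + 1) (by omega)]

/-- The exponential form: `∏ (1 + κ j) - 1 ≤ exp (∑ κ j) - 1`. -/
theorem prod_one_add_le_exp_sum (κ : ℕ → ℝ) (s : Finset ℕ) (hκ : ∀ j, 0 ≤ κ j) :
    ∏ j ∈ s, (1 + κ j) - 1 ≤ Real.exp (∑ j ∈ s, κ j) - 1 := by
  have : ∏ j ∈ s, (1 + κ j) ≤ ∏ j ∈ s, Real.exp (κ j) := by
    refine prod_le_prod (fun j _ => by linarith [hκ j]) (fun j _ => ?_)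
    linarith [Real.add_one_le_exp (κ j)]
  rw [Real.exp_sum]
  linarith

end Summit.AnomalousDissipation.SoloBlind.BackwardGronwall
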